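import Summits.Ventures.PercRepro.C025ProfileFourCapETripleD
import Summits.Ventures.PercRepro.C025ProfileFourCapEBig
/-!
# THE ROW (2,4) OF THE PROFILE INEQUALITY (C-032) FOR EVERY FINITE MATROID (night-3 g10)
NIGHT3-G10-CAPE-PROOF.md, the assembly. `(Cap)` of rule E on a simple matroid of rank `R ≥ 5`: a rank-`4` set `S`
has `|S| = 4` (`capE_sum_of_card_four`), `|S| = 5` without a rank-`2` triple (`capE_sum_of_card_five_free`), `|S| = 5`
with one (`capE_sum_of_card_five_triple`: the outer total `sum_outer_le` with `k ∈ {0, 3, 6}`, the fat and inner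
shares of `C025ProfileFourCapETripleB`, and the arithmetic lemma `loadBound_le_one`), or `|S| ≥ 6`
(`capE_sum_of_six_le`). Hence **`capE_of_simple`**, and with `dem_wE` and the reductions,
**`profileIneq_two_four : ∀ M, Profile.ProfileIneq M 2 4`** — the row `(2,4)` of C-032 on every finite matroid:
`#{S : ρ(S) = 4} ≥ Σ_{B : ρ(B) = 2, ρ(E∖B) ≥ 4} C(ρ(E∖B)+2, 4)/C(ρ(E∖B)+2, 2)` — and, through `hallIneq_of_cert`
and the Hall-side reduction `hallIneq_row_of_simple`, the row `(2,4)` of the Hall form C-033 for every family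
(**`hallIneq_two_four`**).
-/
open scoped Matroid
namespace PercRepro
open Set Finset ThmH CapEArith
section CapEAssembly
variable {α : Type} [DecidableEq α] {M : Matroid α} [M.Finite]

/-- The number `k` of paying outer pairs: `0` under the corank-count condition, `3` in the exceptional cell, else `6`. -/
def outerCount (R ℓ f N : ℕ) : ℕ :=
  if Nat.choose (min R (f + 1)) 2 ≤ Nat.choose (R - 2) 2 + (ℓ + f - 2 - (R - 2)) * (R - 3) then 0
  else if f = 4 ∧ N = 5 then 3 else 6

/-- **The outer total** is at most `k/(6(R−3))`. -/
theorem sum_outer_le {R : ℕ} (hR : M.eRank = R) (h5R : 5 ≤ R) (hsimple : ∀ T ⊆ M.E, T.encard ≤ 2 → M.Indep T)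
    {S T₀ : Finset α} (hS : S ∈ Shadow.levelSet M 4) (h5 : S.card = 5) (hT : T₀ ⊆ S) (hTc : T₀.card = 3)
    (hT2 : M.eRk (T₀ : Set α) = 2) :
    ∑ x ∈ T₀, ∑ c ∈ S \ T₀, wE M {x, c} S ≤
      ((outerCount R (clF M T₀).card (Fs M T₀).card (Gfam M T₀).card : ℕ) : ℚ) / (6 * ((R : ℚ) - 3)) := by
  have hR3 : (0 : ℚ) < 6 * ((R : ℚ) - 3) := by
    have : (5 : ℚ) ≤ R := by exact_mod_cast h5R
    linarith
  have hbound := fun (x : α) (hx : x ∈ T₀) (c : α) (hc : c ∈ S \ T₀) =>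
    wE_outer_le hR h5R hsimple hS h5 hT hTc hT2 hx hc
  unfold outerCount
  split_ifs with hcond hfine
  · -- every outer share is `0`
    rw [Nat.cast_zero, zero_div]
    apply Finset.sum_nonpos
    intro x hx
    apply Finset.sum_nonpos
    intro c hc
    have := hbound x hx c hc
    rwa [if_pos hcond] at this
  · -- the exceptional cell: one of the two points of `S ∖ T₀` kills its three pairs
    obtain ⟨c₀, hc₀, hzero⟩ := exists_outer_zero_of_fine hR h5R hsimple hS h5 hT hTc hT2 hfine.1 hfine.2
    have hc2 : (S \ T₀).card = 2 := by rw [Finset.card_sdiff_of_subset hT, h5, hTc]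
    obtain ⟨a, b, hab, hab'⟩ := Finset.card_eq_two.1 hc2
    have hone : ∀ x ∈ T₀, ∑ c ∈ S \ T₀, wE M {x, c} S ≤ 1 / (6 * ((R : ℚ) - 3)) := by
      intro x hx
      rw [hab', Finset.sum_pair hab]
      have ha : a ∈ S \ T₀ := by rw [hab']; exact Finset.mem_insert_self _ _
      have hb : b ∈ S \ T₀ := by rw [hab']; exact Finset.mem_insert_of_mem (Finset.mem_singleton_self _)
      have hba := hbound x hx a ha
      have hbb := hbound x hx b hb
      rw [if_neg hcond] at hba hbb
      have hc₀ab : c₀ = a ∨ c₀ = b := by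
        have := hc₀; rw [hab', Finset.mem_insert, Finset.mem_singleton] at this; exact this
      rcases hc₀ab with rfl | rfl
      · rw [hzero x hx]; linarith
      · rw [hzero x hx]; linarith
    calc ∑ x ∈ T₀, ∑ c ∈ S \ T₀, wE M {x, c} S ≤ ∑ x ∈ T₀, 1 / (6 * ((R : ℚ) - 3)) :=
          Finset.sum_le_sum hone
      _ = ((3 : ℕ) : ℚ) / (6 * ((R : ℚ) - 3)) := by
          rw [Finset.sum_const, hTc, nsmul_eq_mul]; push_cast; ring
  · -- six shares of at most `1/(6(R−3))`
    have hc2 : (S \ T₀).card = 2 := by rw [Finset.card_sdiff_of_subset hT, h5, hTc]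
    have hone : ∀ x ∈ T₀, ∑ c ∈ S \ T₀, wE M {x, c} S ≤ 2 * (1 / (6 * ((R : ℚ) - 3))) := by
      intro x hx
      calc ∑ c ∈ S \ T₀, wE M {x, c} S ≤ ∑ c ∈ S \ T₀, 1 / (6 * ((R : ℚ) - 3)) := by
            apply Finset.sum_le_sum
            intro c hc
            have := hbound x hx c hc
            rwa [if_neg hcond] at this
        _ = 2 * (1 / (6 * ((R : ℚ) - 3))) := by rw [Finset.sum_const, hc2, nsmul_eq_mul]; push_cast; ring
    calc ∑ x ∈ T₀, ∑ c ∈ S \ T₀, wE M {x, c} S ≤ ∑ x ∈ T₀, 2 * (1 / (6 * ((R : ℚ) - 3))) :=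
          Finset.sum_le_sum hone
      _ = ((6 : ℕ) : ℚ) / (6 * ((R : ℚ) - 3)) := by
          rw [Finset.sum_const, hTc, nsmul_eq_mul]; push_cast; ring

/-- **(Cap) on a five-point set with a collinear triple.** -/
theorem capE_sum_of_card_five_triple {R : ℕ} (hR : M.eRank = R) (h5R : 5 ≤ R)
    (hsimple : ∀ T ⊆ M.E, T.encard ≤ 2 → M.Indep T) {S T₀ : Finset α} (hS : S ∈ Shadow.levelSet M 4)
    (h5 : S.card = 5) (hT : T₀ ⊆ S) (hTc : T₀.card = 3) (hT2 : M.eRk (T₀ : Set α) = 2) :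
    ∑ B ∈ (Profile.Rq M 2).filter (fun B => B ⊆ S), wE M B S ≤ 1 := by
  obtain ⟨hSg, hS4⟩ := Profile.mem_levelSet.1 hS
  have hTq : T₀ ∈ Profile.Rq M 2 := Profile.mem_Rq.2 ⟨hT.trans hSg, hT2⟩
  set ℓ := (clF M T₀).card with hℓ
  set f := (Fs M T₀).card with hf
  set q := (M.eRk ((Fs M T₀ : Finset α) : Set α)).toNat with hq
  set N := (Gfam M T₀).card with hN
  set k := outerCount R ℓ f N with hk
  -- the three pieces
  have hdecomp := sum_wE_triple_decomp hsimple hS h5 hT hTc hT2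
  have hfat := wE_triple_le hR h5R hS h5 hT hTc hT2
  have hinner : ∑ B ∈ T₀.powersetCard 2, wE M B S ≤
      3 * (((Nat.choose (pIn R ℓ q) 2 - N : ℕ) : ℚ) / (6 * ((ℓ - 2 : ℕ) : ℚ) * (N : ℚ))) := by
    calc ∑ B ∈ T₀.powersetCard 2, wE M B S
        ≤ ∑ B ∈ T₀.powersetCard 2, ((Nat.choose (pIn R ℓ q) 2 - N : ℕ) : ℚ) / (6 * ((ℓ - 2 : ℕ) : ℚ) * (N : ℚ)) := by
          apply Finset.sum_le_sum
          intro B hB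
          rw [Finset.mem_powersetCard] at hB
          exact wE_inner_le hR hsimple hS h5 hT hTc hT2 hB.1 hB.2
      _ = 3 * (((Nat.choose (pIn R ℓ q) 2 - N : ℕ) : ℚ) / (6 * ((ℓ - 2 : ℕ) : ℚ) * (N : ℚ))) := by
          rw [Finset.sum_const, Finset.card_powersetCard, hTc, nsmul_eq_mul]
          norm_num [Nat.choose]
  have houter := sum_outer_le hR h5R hsimple hS h5 hT hTc hT2
  -- the constraints
  obtain ⟨_, hq1, hq2, hq3⟩ := q_bounds hR hTq
  obtain ⟨hN1, hN2⟩ := card_Gfam_triple_bounds hR hTq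
  have hℓ3 : 3 ≤ ℓ := by
    have := Finset.card_le_card (subset_clF_self (hT.trans hSg))
    omega
  have hconstr : Constr R ℓ f q N k := by
    refine ⟨h5R, hℓ3, hq1, hq2, hq3, hN1, hN2, ?_, ?_, ?_⟩
    · rw [hk]; unfold outerCount; split_ifs <;> omega
    · intro hc; rw [hk]; unfold outerCount; rw [if_pos hc]
    · intro hf4 hN5; rw [hk]; unfold outerCount; split_ifs <;> omega
  have harith := loadBound_le_one hconstr
  unfold loadBound at harith
  have hB3 : ((R - 3 : ℕ) : ℚ) = (R : ℚ) - 3 := by rw [Nat.cast_sub (by omega)]; push_cast; ring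
  rw [hB3] at harith
  linarith

/-- **(Cap) OF RULE E ON EVERY SIMPLE MATROID OF RANK `≥ 5`.** -/
theorem capE_of_simple (N : Matroid α) [N.Finite] (hsimple : ∀ T ⊆ N.E, T.encard ≤ 2 → N.Indep T)
    (hR5 : (5 : ℕ∞) ≤ N.eRank) : CapE N := by
  have hRtop : N.eRank ≠ ⊤ := N.eRank_ne_top_iff.2 inferInstance
  obtain ⟨R, hR⟩ := ENat.ne_top_iff_exists.1 hRtop
  have hR' : N.eRank = R := hR.symm
  have h5R : 5 ≤ R := by rw [← hR] at hR5; exact_mod_cast hR5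
  intro S hS
  obtain ⟨hSg, hS4⟩ := Profile.mem_levelSet.1 hS
  have h4 : 4 ≤ S.card := by
    have := eRk_le_card (M := N) S
    rw [hS4] at this
    exact_mod_cast this
  rcases Nat.lt_or_ge S.card 6 with hlt | hge
  · rcases Nat.lt_or_ge S.card 5 with hlt5 | hge5
    · exact capE_sum_of_card_four hS (by omega)
    · have h5 : S.card = 5 := by omega
      by_cases htrip : ∃ T ⊆ S, T.card = 3 ∧ N.eRk (T : Set α) = 2
      · obtain ⟨T₀, hT, hTc, hT2⟩ := htrip
        exact capE_sum_of_card_five_triple hR' h5R hsimple hS h5 hT hTc hT2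
      · push Not at htrip
        exact capE_sum_of_card_five_free hR' h5R hS h5 htrip
  · exact capE_sum_of_six_le hR' h5R hsimple hS hge

/-- **THE ROW `(2,4)` OF THE PROFILE INEQUALITY FOR EVERY FINITE MATROID.** -/
theorem profileIneq_two_four (M : Matroid α) [M.Finite] : Profile.ProfileIneq M 2 4 :=
  profileIneq_two_four_of_capE (fun N _ hs hR => capE_of_simple N hs hR) M

/-- `(H⁺_{2,4})` on a simple matroid: rank `< 4` is the empty level, rank `4` the top level, rank `≥ 5` the certificate. -/
theorem hallIneq_two_four_of_simple_all (N : Matroid α) [N.Finite]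
    (hsimple : ∀ T ⊆ N.E, T.encard ≤ 2 → N.Indep T) : Profile.HallIneq N 2 4 := by
  have hRtop : N.eRank ≠ ⊤ := N.eRank_ne_top_iff.2 inferInstance
  obtain ⟨R, hRe⟩ := ENat.ne_top_iff_exists.1 hRtop
  rcases Nat.lt_or_ge R 4 with hlt4 | hge4
  · apply hallIneq_of_eRank_lt
    rw [← hRe]; exact_mod_cast hlt4
  rcases Nat.lt_or_ge R 5 with hlt5 | hge5
  · have heq4 : R = 4 := by omega
    exact hallIneq_top (R := 4) (by rw [← hRe, heq4]) 2
  · have hR5 : (5 : ℕ∞) ≤ N.eRank := by rw [← hRe]; exact_mod_cast hge5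
    exact hallIneq_of_cert 2 4 (wE N) (fun B S => wE_nonneg B S) (capE_of_simple N hsimple hR5)
      (fun _ hB => dem_wE hR5 hB)

/-- **THE ROW `(2,4)` OF THE HALL FORM (C-033) FOR EVERY FINITE MATROID AND EVERY FAMILY OF RANK-`2` SETS.** -/
theorem hallIneq_two_four (M : Matroid α) [M.Finite] : Profile.HallIneq M 2 4 :=
  hallIneq_row_of_simple (q := 1) (u := 3) (by omega) (fun N _ hs => hallIneq_two_four_of_simple_all N hs)
    (fun N _ => hallIneq_one_all N 3 (by omega)) M

end CapEAssembly
end PercRepro
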